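import Mathlib
import Summits.NavierStokesRegularity.NavierStokesRegularity.Theorems.EulerZoomLiouvillePowerGaugeEulerLiouvilleChiralAnchorRace
import Summits.NavierStokesRegularity.NavierStokesRegularity.Theorems.EulerZoomLiouvillePowerGaugeEulerLiouvilleSwirlfreeLedgerDecay
import HarnessLib

/-!
# Crux `EulerZoomLiouville.PowerGaugeEulerLiouville` (stmt-NavierStokesRegularity-19832), width sub-line `chiral_anchor` (ns-idea-11 g10),
# stub K4 `stub_anchorRace` (THE RACE) — part (e): THE K4 FILLER

Seat ns-ezl-w3 g8 (`--supports stmt-NavierStokesRegularity-19832 --as helper`).  ★ `ChiralAnchor.stub_anchorRace_filler` = `Sig.stub_anchorRace`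
of `Cruxes/PowerGaugeEulerLiouville/Lines/chiral_anchor.lean` (d6f05783883b5e52), δ-unfolded VERBATIM:
`ShellHelicityFloor → FarVolumeBound → ∀ ρ > 0, ∀ u p H c, InClass ρ u p H c → IsChiralTubePast u p → HasAnchorFlows u → False`.
Unpacking: the `A`/`E`-gauges from the class bound (`SwirlfreeLedger.setLIntegral_window_frobenius_fderiv_le` reads the `E`-gauge on the classical
gradient), the scale `A` from `exists_large_scale`, the slab bound and the anchor flow on `[t₀ − A², t₀]`, the far-volume bound along it, and
`ChiralAnchor.race_contradiction`.  (ns-idea-11 g10 proved K4 independently IN the line file, REV4 `K4.anchorRace`; this is the TREE theorem the LEAD's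
member `InClass → IsChiralTubePast → False` consumes BY NAME together with K1 `stub_anchorFlow_filler`, K2/K3 ported by ns-ezl-w1.)

HONEST FRAMING: with K1–K3 this empties the chiral-tube STRATUM of the MODEL-lattice crux class for every `ρ > 0`; the line's K6 (the crux's open
complement) is untouched; nothing about the crux E (19832 OPEN) or NS regularity is proved; not E. [cite: Moffatt1969, §3; CaffarelliKohnNirenberg1982, §2]
-/

noncomputable section

set_option linter.dupNamespace false

open MeasureTheory Set Filter Topology Metric Function InnerProductSpace
open scoped RealInnerProductSpace NNReal ENNReal ContDiff Topology

namespace Summit.NavierStokesRegularity.NavierStokesRegularity.Theorems.PowerGaugeEulerLiouville.ChiralAnchor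

open Literature.Analysis Literature.Analysis.FluidPDE
open Summit.NavierStokesRegularity.NavierStokesRegularity.Theorems.PowerGaugeEulerLiouville

/-- ★ **K4 `stub_anchorRace`** (= `Sig.stub_anchorRace` of `Lines/chiral_anchor.lean`, δ-unfolded VERBATIM): given the shell helicity floor and the
far-volume bound, a member of Seregin's class (ANY `ρ > 0`) in the chiral-tube stratum with anchor flows is absurd.  LEAD / line:
`exact ChiralAnchor.stub_anchorRace_filler`. [cite: Moffatt1969, §3; CaffarelliKohnNirenberg1982, §2] -/
theorem stub_anchorRace_filler :
    (∃ C : ℝ, 0 < C ∧ ∀ R : ℝ, 0 < R → ∀ v : (EuclideanSpace ℝ (Fin 3)) → (EuclideanSpace ℝ (Fin 3)), ContDiff ℝ 1 v →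
    ∀ w : (EuclideanSpace ℝ (Fin 3)) → ℝ, Measurable w → (∀ x : (EuclideanSpace ℝ (Fin 3)), |w x| ≤ 1) →
      ∀ T : Set (EuclideanSpace ℝ (Fin 3)), MeasurableSet T → volume T < ⊤ → (∀ x : (EuclideanSpace ℝ (Fin 3)), x ∉ T → w x = 0) →
        |∫ x in Metric.ball (0 : (EuclideanSpace ℝ (Fin 3))) R, w x * inner ℝ (v x) (Literature.Analysis.FluidPDE.curl v x)| ≤
          C * (volume T).toReal ^ (1 / 3 : ℝ) *
              (Real.sqrt (∫ x in Metric.ball (0 : (EuclideanSpace ℝ (Fin 3))) R, ‖fderiv ℝ v x‖ ^ 2) +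
                R⁻¹ * Real.sqrt (∫ x in Metric.ball (0 : (EuclideanSpace ℝ (Fin 3))) R, ‖v x‖ ^ 2)) *
            Real.sqrt (∫ x in Metric.ball (0 : (EuclideanSpace ℝ (Fin 3))) R, ‖Literature.Analysis.FluidPDE.curl v x‖ ^ 2)) →
    (∃ C : ℝ, 0 < C ∧ ∀ ρ : ℝ, 0 < ρ →
    ∀ (u : ℝ → (EuclideanSpace ℝ (Fin 3)) → (EuclideanSpace ℝ (Fin 3))) (p : ℝ → (EuclideanSpace ℝ (Fin 3)) → ℝ) (H : ℝ → (EuclideanSpace ℝ (Fin 3)) → (EuclideanSpace ℝ (Fin 3)) →L[ℝ] (EuclideanSpace ℝ (Fin 3))) (c : ℝ≥0), (Literature.Analysis.FluidPDE.IsSuitableWeakSolutionOn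
      (Literature.Analysis.FluidPDE.slab (EuclideanSpace ℝ (Fin 3)) (Set.Iio 0) isOpen_Iio) 0 0 u p ∧
    Literature.Analysis.FluidPDE.HasWeakSpatialGradientOn
      (Literature.Analysis.FluidPDE.slab (EuclideanSpace ℝ (Fin 3)) (Set.Iio 0) isOpen_Iio) u H ∧
    (∀ a : ℝ, 0 < a →
      ENNReal.ofReal (a ^ (2 * ρ)) * Literature.Analysis.FluidPDE.cknA a (0 : ℝ × (EuclideanSpace ℝ (Fin 3))) u +
          ENNReal.ofReal (a ^ ρ) * Literature.Analysis.FluidPDE.cknE a (0 : ℝ × (EuclideanSpace ℝ (Fin 3))) H +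
        ENNReal.ofReal (a ^ (2 * ρ)) * Literature.Analysis.FluidPDE.cknD a (0 : ℝ × (EuclideanSpace ℝ (Fin 3))) p ≤ (c : ℝ≥0∞))) →
      Literature.Analysis.FluidPDE.IsClassicalEulerSolutionOn (Set.Iio 0) 0 u p →
        ∀ (t₁ t₀ : ℝ) (T : Set (EuclideanSpace ℝ (Fin 3))) (X : ℝ → (EuclideanSpace ℝ (Fin 3)) → (EuclideanSpace ℝ (Fin 3))), t₁ < t₀ → t₀ < 0 → MeasurableSet T → (Continuous (fun q : ℝ × (EuclideanSpace ℝ (Fin 3)) => X q.1 q.2) ∧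
    (∀ y ∈ T, X t₀ y = y) ∧
    (∀ r ∈ Set.Icc t₁ t₀, ∀ y ∈ T, HasDerivWithinAt (fun σ : ℝ => X σ y) (u r (X r y)) (Set.Icc t₁ t₀) r) ∧
    (∀ r ∈ Set.Icc t₁ t₀, Set.InjOn (X r) T) ∧
    (∀ r ∈ Set.Icc t₁ t₀, ∀ S ⊆ T, MeasurableSet S → MeasurableSet (X r '' S) ∧ volume (X r '' S) = volume S) ∧
    (∀ r ∈ Set.Icc t₁ t₀, ∀ S ⊆ T, MeasurableSet S → ∀ g : (EuclideanSpace ℝ (Fin 3)) → ℝ≥0∞, Measurable g →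
      ∫⁻ x in X r '' S, g x = ∫⁻ y in S, g (X r y)) ∧
    (∃ R' : ℝ, ∀ r ∈ Set.Icc t₁ t₀, X r '' T ⊆ Metric.ball (0 : (EuclideanSpace ℝ (Fin 3))) R')) →
          ∀ R₀ : ℝ, 0 < R₀ → T ⊆ Metric.ball (0 : (EuclideanSpace ℝ (Fin 3))) R₀ →
            ∀ R : ℝ, 2 * R₀ ≤ R → -R ^ 2 < t₁ →
              ∀ s ∈ Set.Icc t₁ t₀, ∀ E₀ ⊆ T, MeasurableSet E₀ → (∀ y ∈ E₀, R ≤ ‖X s y‖) →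
                (volume E₀).toReal ^ (1 / 6 : ℝ) * (R - R₀) ≤
                  C * Real.sqrt (c : ℝ) * (Real.sqrt (t₀ - s) * R ^ ((1 - ρ) / 2) + (t₀ - s) * R ^ (-(1 / 2 + ρ)))) →
    ∀ ρ : ℝ, 0 < ρ → ∀ (u : ℝ → (EuclideanSpace ℝ (Fin 3)) → (EuclideanSpace ℝ (Fin 3))) (p : ℝ → (EuclideanSpace ℝ (Fin 3)) → ℝ) (H : ℝ → (EuclideanSpace ℝ (Fin 3)) → (EuclideanSpace ℝ (Fin 3)) →L[ℝ] (EuclideanSpace ℝ (Fin 3))) (c : ℝ≥0),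
      (Literature.Analysis.FluidPDE.IsSuitableWeakSolutionOn
      (Literature.Analysis.FluidPDE.slab (EuclideanSpace ℝ (Fin 3)) (Set.Iio 0) isOpen_Iio) 0 0 u p ∧
    Literature.Analysis.FluidPDE.HasWeakSpatialGradientOn
      (Literature.Analysis.FluidPDE.slab (EuclideanSpace ℝ (Fin 3)) (Set.Iio 0) isOpen_Iio) u H ∧
    (∀ a : ℝ, 0 < a →
      ENNReal.ofReal (a ^ (2 * ρ)) * Literature.Analysis.FluidPDE.cknA a (0 : ℝ × (EuclideanSpace ℝ (Fin 3))) u +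
          ENNReal.ofReal (a ^ ρ) * Literature.Analysis.FluidPDE.cknE a (0 : ℝ × (EuclideanSpace ℝ (Fin 3))) H +
        ENNReal.ofReal (a ^ (2 * ρ)) * Literature.Analysis.FluidPDE.cknD a (0 : ℝ × (EuclideanSpace ℝ (Fin 3))) p ≤ (c : ℝ≥0∞))) →
      (Literature.Analysis.FluidPDE.IsClassicalEulerSolutionOn (Set.Iio 0) 0 u p ∧
    ∃ t₀ : ℝ, t₀ < 0 ∧
      (∀ t₁ : ℝ, t₁ < t₀ → ∃ B : ℝ, ∀ r ∈ Set.Icc t₁ t₀, ∀ x : (EuclideanSpace ℝ (Fin 3)), ‖u r x‖ ≤ B) ∧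
      ∃ (χ : (EuclideanSpace ℝ (Fin 3)) → ℝ) (R : ℝ), 0 < R ∧ (ContDiff ℝ ∞ χ ∧ (∀ x : (EuclideanSpace ℝ (Fin 3)), |χ x| ≤ 1) ∧ (∀ x : (EuclideanSpace ℝ (Fin 3)), R ≤ ‖x‖ → χ x = 0) ∧
    ∀ x : (EuclideanSpace ℝ (Fin 3)), fderiv ℝ χ x (Literature.Analysis.FluidPDE.curl (u t₀) x) = 0) ∧ (∫ x, χ x * inner ℝ (u t₀ x) (Literature.Analysis.FluidPDE.curl (u t₀) x)) ≠ 0) →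
      (∀ t₀ : ℝ, t₀ < 0 → ∀ t₁ : ℝ, t₁ < t₀ →
          (∃ B : ℝ, ∀ r ∈ Set.Icc t₁ t₀, ∀ x : EuclideanSpace ℝ (Fin 3), ‖u r x‖ ≤ B) →
            ∀ (χ : EuclideanSpace ℝ (Fin 3) → ℝ) (R : ℝ), 0 < R →
              (ContDiff ℝ ∞ χ ∧ (∀ x : EuclideanSpace ℝ (Fin 3), |χ x| ≤ 1) ∧ (∀ x : EuclideanSpace ℝ (Fin 3), R ≤ ‖x‖ → χ x = 0) ∧
                ∀ x : EuclideanSpace ℝ (Fin 3), fderiv ℝ χ x (curl (u t₀) x) = 0) →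
              ∃ (X : ℝ → EuclideanSpace ℝ (Fin 3) → EuclideanSpace ℝ (Fin 3)) (χ' : ℝ → EuclideanSpace ℝ (Fin 3) → ℝ),
                (Continuous (fun q : ℝ × EuclideanSpace ℝ (Fin 3) => X q.1 q.2) ∧
                  (∀ y ∈ {x : EuclideanSpace ℝ (Fin 3) | χ x ≠ 0}, X t₀ y = y) ∧
                  (∀ r ∈ Set.Icc t₁ t₀, ∀ y ∈ {x : EuclideanSpace ℝ (Fin 3) | χ x ≠ 0},
                    HasDerivWithinAt (fun σ : ℝ => X σ y) (u r (X r y)) (Set.Icc t₁ t₀) r) ∧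
                  (∀ r ∈ Set.Icc t₁ t₀, Set.InjOn (X r) {x : EuclideanSpace ℝ (Fin 3) | χ x ≠ 0}) ∧
                  (∀ r ∈ Set.Icc t₁ t₀, ∀ S ⊆ {x : EuclideanSpace ℝ (Fin 3) | χ x ≠ 0}, MeasurableSet S →
                    MeasurableSet (X r '' S) ∧ volume (X r '' S) = volume S) ∧
                  (∀ r ∈ Set.Icc t₁ t₀, ∀ S ⊆ {x : EuclideanSpace ℝ (Fin 3) | χ x ≠ 0}, MeasurableSet S →
                    ∀ g : EuclideanSpace ℝ (Fin 3) → ℝ≥0∞, Measurable g → ∫⁻ x in X r '' S, g x = ∫⁻ y in S, g (X r y)) ∧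
                  (∃ R' : ℝ, ∀ r ∈ Set.Icc t₁ t₀, X r '' {x : EuclideanSpace ℝ (Fin 3) | χ x ≠ 0} ⊆
                    Metric.ball (0 : EuclideanSpace ℝ (Fin 3)) R')) ∧
                (χ' t₀ = χ ∧
                  ∀ r ∈ Set.Icc t₁ t₀,
                    (∃ R' : ℝ, 0 < R' ∧ (ContDiff ℝ ∞ (χ' r) ∧ (∀ x : EuclideanSpace ℝ (Fin 3), |χ' r x| ≤ 1) ∧
                      (∀ x : EuclideanSpace ℝ (Fin 3), R' ≤ ‖x‖ → χ' r x = 0) ∧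
                      ∀ x : EuclideanSpace ℝ (Fin 3), fderiv ℝ (χ' r) x (curl (u r) x) = 0)) ∧
                    (∀ y ∈ {x : EuclideanSpace ℝ (Fin 3) | χ x ≠ 0}, χ' r (X r y) = χ y) ∧
                    (∀ x : EuclideanSpace ℝ (Fin 3), χ' r x ≠ 0 → x ∈ X r '' {x : EuclideanSpace ℝ (Fin 3) | χ x ≠ 0}) ∧
                    ∫ x, χ' r x * inner ℝ (u r x) (curl (u r) x) = ∫ x, χ x * inner ℝ (u t₀ x) (curl (u t₀) x))) → False := by
  intro hSHF hFVB ρ hρ u p H c hcls hct hAF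
  obtain ⟨C, hC, hF⟩ := hSHF
  obtain ⟨CV, hCV, hFV⟩ := hFVB
  have hcls' := hcls
  obtain ⟨_, hH, hgauge⟩ := hcls
  obtain ⟨hcl, t₀, ht₀, hslab, χ, R, hR, ⟨hχs, hχ1, hχ0, hχi⟩, hH₀ne⟩ := hct
  -- the gauges
  have hA : ∀ a : ℝ, 0 < a → ENNReal.ofReal (a ^ (2 * ρ)) * cknA a (0 : ℝ × EuclideanSpace ℝ (Fin 3)) u ≤ (c : ℝ≥0∞) :=
    fun a ha => (le_self_add.trans le_self_add).trans (hgauge a ha)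
  have hE : ∀ a : ℝ, 0 < a → ENNReal.ofReal (a ^ ρ) * cknE a (0 : ℝ × EuclideanSpace ℝ (Fin 3)) H ≤ (c : ℝ≥0∞) :=
    fun a ha => (le_add_self.trans le_self_add).trans (hgauge a ha)
  have hEwin : ∀ a : ℝ, 0 < a → ∫⁻ z in Ioo (-a ^ 2) 0 ×ˢ ball (0 : EuclideanSpace ℝ (Fin 3)) a,
      ENNReal.ofReal (frobeniusNormSq (fderiv ℝ (u z.1) z.2)) ≤ ENNReal.ofReal ((c : ℝ) * a ^ (1 - ρ)) :=
    fun a ha => SwirlfreeLedger.setLIntegral_window_frobenius_fderiv_le hH hcl hE ha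
  -- the helicity and the label set
  obtain ⟨H₀, hH₀def⟩ : ∃ H₀ : ℝ, H₀ = ∫ x, χ x * ⟪u t₀ x, curl (u t₀) x⟫ := ⟨_, rfl⟩
  have hH₀ : H₀ ≠ 0 := by rw [hH₀def]; exact hH₀ne
  have hχc : Continuous χ := hχs.continuous
  have hTm : MeasurableSet ({x | χ x ≠ 0} : Set (EuclideanSpace ℝ (Fin 3))) := (isOpen_ne_fun hχc continuous_const).measurableSet
  have hTball : ({x | χ x ≠ 0} : Set (EuclideanSpace ℝ (Fin 3))) ⊆ ball (0 : EuclideanSpace ℝ (Fin 3)) R := fun x hx => by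
    rw [mem_ball_zero_iff]; by_contra h; exact hx (hχ0 x (not_lt.1 h))
  -- the scale
  obtain ⟨A, hA1, hAR, hAt, hAlt⟩ := exists_large_scale hρ
    (8 * C * (‖curlCLM‖ + 1) * c * ((volume {x | χ x ≠ 0}).toReal + 1) ^ (1 / 3 : ℝ) / |H₀|)
    (16 * C ^ 2 * (‖curlCLM‖ + 1) ^ 2 * c * ((c : ℝ) + 1) * ((volume {x | χ x ≠ 0}).toReal + 1) ^ (2 / 3 : ℝ) / |H₀| ^ 2)
    (64 * C * (‖curlCLM‖ + 1) * CV ^ 2 * (Real.sqrt c + 1) ^ 2 * c / |H₀| *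
              ∑' j : ℕ, ((j : ℝ) + 1) * ((j : ℝ) + 2) * ((2 : ℝ) ^ (-2 * ρ)) ^ j +
            1024 * C ^ 2 * (‖curlCLM‖ + 1) ^ 2 * CV ^ 4 * (Real.sqrt c + 1) ^ 4 * c * ((c : ℝ) + 1) / |H₀| ^ 2 *
              ∑' j : ℕ, (((j : ℝ) + 1) * ((j : ℝ) + 2)) ^ 2 * ((2 : ℝ) ^ (-2 - 2 * ρ)) ^ j) R (-t₀)
  have hA0 : 0 < A := lt_of_lt_of_le one_pos hA1
  have ht₁ : t₀ - A ^ 2 < t₀ := by nlinarith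
  -- the slab bound and the anchor flow on `[t₀ − A², t₀]`
  obtain ⟨B, hB⟩ := hslab (t₀ - A ^ 2) ht₁
  obtain ⟨X, χ', hX, hTr⟩ := hAF t₀ ht₀ (t₀ - A ^ 2) ht₁ ⟨B, hB⟩ χ R hR ⟨hχs, hχ1, hχ0, hχi⟩
  have hX' := hX
  obtain ⟨hXc, -, -, -, hXvol, -, ⟨R', hXball⟩⟩ := hX'
  obtain ⟨-, hTr'⟩ := hTr
  -- the far-volume bound along the anchor flow
  have hfar : ∀ Rf : ℝ, 2 * R ≤ Rf → -Rf ^ 2 < t₀ - A ^ 2 → ∀ s ∈ Icc (t₀ - A ^ 2) t₀, ∀ E₀ ⊆ {x | χ x ≠ 0}, MeasurableSet E₀ →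
      (∀ y ∈ E₀, Rf ≤ ‖X s y‖) →
        (volume E₀).toReal ^ (1 / 6 : ℝ) * (Rf - R) ≤
          CV * Real.sqrt (c : ℝ) * (Real.sqrt (t₀ - s) * Rf ^ ((1 - ρ) / 2) + (t₀ - s) * Rf ^ (-(1 / 2 + ρ))) :=
    fun Rf h2R hRt s hs E₀ hE₀ hE₀m hfc =>
      hFV ρ hρ u p H c hcls' hcl (t₀ - A ^ 2) t₀ {x | χ x ≠ 0} X ht₁ ht₀ hTm hX R hR hTball Rf h2R hRt s hs E₀ hE₀ hE₀m hfc
  -- the transported weights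
  have hχ'c : ∀ r ∈ Icc (t₀ - A ^ 2) t₀, Continuous (χ' r) := fun r hr => by
    obtain ⟨⟨_, _, hcd, -, -, -⟩, -, -, -⟩ := hTr' r hr
    exact hcd.continuous
  have hχ'1 : ∀ r ∈ Icc (t₀ - A ^ 2) t₀, ∀ x, |χ' r x| ≤ 1 := fun r hr => by
    obtain ⟨⟨_, _, -, h1, -, -⟩, -, -, -⟩ := hTr' r hr
    exact h1
  have hχ'supp : ∀ r ∈ Icc (t₀ - A ^ 2) t₀, ∀ x, χ' r x ≠ 0 → x ∈ X r '' {x | χ x ≠ 0} := fun r hr => (hTr' r hr).2.2.1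
  have hhel : ∀ r ∈ Icc (t₀ - A ^ 2) t₀, ∫ x, χ' r x * ⟪u r x, curl (u r) x⟫ = H₀ := fun r hr => by
    rw [hH₀def]; exact (hTr' r hr).2.2.2
  exact race_contradiction hρ hcl hA hEwin hC hF hCV ht₀ hχc hχ0 hH₀ hA1 hAR hAt hAlt hXc hXvol hXball hfar hχ'c hχ'1 hχ'supp hhel

end Summit.NavierStokesRegularity.NavierStokesRegularity.Theorems.PowerGaugeEulerLiouville.ChiralAnchor

end
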